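import Summits.ValiantsHypothesis.ValiantsHypothesis.Theses.BorderApolarity
import Literature.Computability.AlgebraicComplexity.Apolarity
import Literature.Computability.AlgebraicComplexity.ApolarityAction
import Summits.ValiantsHypothesis.ValiantsHypothesis.Theorems.ToricFixedPoints.Negative.WithoutOrbitFalse
import Summits.ValiantsHypothesis.ValiantsHypothesis.Theorems.BorderApolarityToricFixedPointsToricLimitIsInitial
import Summits.ValiantsHypothesis.ValiantsHypothesis.Theorems.BorderApolarityFixedWitnessObstructionQPAnnSubmodule
import Summits.ValiantsHypothesis.ValiantsHypothesis.Theorems.BorderApolarityFixedWitnessObstructionQPKuratowskiSubmodule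
import Summits.ValiantsHypothesis.ValiantsHypothesis.Theorems.BorderApolarityFixedWitnessObstructionQPLimitIdeal
import Summits.ValiantsHypothesis.ValiantsHypothesis.Theorems.BorderApolarityFixedWitnessObstructionQPH0Elementary
import Summits.ValiantsHypothesis.ValiantsHypothesis.Theorems.BorderApolarityToricFixedPointsH0Families

/-!
# Line `colon-tower-distraction` — skeleton for crux `ToricFixedPoints`
(stmt-ValiantsHypothesis-5779, route `BorderApolarity`, rank 3)

Crux-plan skeleton (planner unit `cruxplan-stmt-ValiantsHypothesis-5779-colon-tower-distract`,
2026-08-16).  Idea card `Cruxes/ToricFixedPoints/Ideas/colon-tower-distraction.md` (crux-ideate r1,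
ideator 1), passed by TRIAGE-r1-1/2/3 and SHARPENED as the panel asked:

* (r1-2 A1) UNIQUENESS in the card's "rigidity (a)" is refuted at `(n,m) = (2,4)` (several discrete
  towers over one z-free skeleton; `rigidity_certificate_n2m4.txt`).  No stub asserts uniqueness or
  rigidity; the distraction stub must produce EVERY tower over a skeleton ("distraction with
  choices": the constant matrices `B_z` carry the choice).
* (r1-1, r1-2, r1-3) the card's lever (b) with cocharacter trivial on `Y' = {ℓ} ∪ Y` only reaches
  End-type skeletons `det A₀(ℓ,Y)`; the honest `m > n` content is "an `H₀`-fixed point whose z-free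
  skeleton is a `T'`-toric limit of an End-type minors system on `Y'` is a z-lexicographic
  distraction of it".  Hence a PRODUCT cocharacter `(w' on Y'; z-weights far below)` — predicate
  `ZLight` — and the skeleton problem is its own stub `stub_skeletonEndToric` (declared HARDEST; it
  contains the unpadded case `m = n` of the crux verbatim and, over `[ℓ^{m-n} per_n]`, the
  "border-dc vs End-toric dc" content the triagers pointed at).
* (r1-2 A3) the colon tower is EMPTY at `(2,3)`, `(3,4)` (no z-tails in degree `m-1` when
  `m² < 2n²+2`); first honest test sizes for `stub_tailDistraction` are `(3,5)` (in range) and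
  `(2,4)` (mechanism level), with the two-step points of `dump24.jsonl` / `dump35_trim.jsonl` as corpus.
* (r1-2 R1, cdisprove "T'-absorption") `u = 1` in the conclusion: the distraction realises `J` with
  `u = 1` directly; `stub_toricKLimit` is nevertheless stated for every `u` (translation commutes
  with Kuratowski limits) and instantiated at `u = 1` in the composition.

THE LINE.  An `H₀(n,m)`-fixed point `J = (J_k)_{k ≤ m}` of `Z_det_m` is, degree by degree, a
subspace of degree-`k` operators of codimension `C(m,k)²` closed under `∂_i`-multiplication
(`stub_limitStructure`: W1 = orbit clause is load-bearing here, cf. Negative/WithoutOrbitFalse) and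
stable under the three kinds of one-parameter subgroups of `H₀` (`stub_h0Families`: `∂_y ↦ ∂_y + c∂_z`
for `y` own / `z` unused = infinitesimal `U_P`-stability C1; `∂_z ↦ ∂_z + c∂_{z'}` for `rk z ≤ rk z'`
= Borel moves C2; the character-kernel torus = the `ℓ`-, row/column-content- and z-multi-gradings
B2).  Dually (`V_k := J_k^⊥ ⊆ S_k`) this is the card's COLON TOWER: `V_k = ⊕_γ F_{k-|γ|}(γ)·z^γ`,
`F_d(γ) ⊆ (F_{d+1}(γ - e_j) : Y')`, strongly stable in the z-index, `Σ dim = C(m,k)²`, top form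
z-free.  The line then claims: (α) `stub_skeletonEndToric` — the z-FREE part of `J` (the skeleton,
`F_•(0)` dually) is the `w'`-initial system of the annihilator, inside `ℂ[∂_{Y'}]`, of the minors of
ONE `m × m` matrix `A₀` of linear forms in the `n²+1` own variables; (β) `stub_tailDistraction` — given
(α), the whole tower is realised torically: `J_k = in_w(Ann_k(g·det_m))` for a translate `g` (intended:
`g·x = A₀' + Σ_z z·B_z`, the `B_z` solved degree by degree top-down through the iterated colons — the
distraction/polarisation of a strongly stable staircase, Hartshorne 1966 / Bigatti–Conca–Robbiano 2005
for monomial ideals, BuczynskaBuczynski2021 Cor 41 "move-fit" for Slip) with weights `w` in which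
every unused variable lies far BELOW every own one (`ZLight`); (γ) `stub_toricKLimit` — along the
toric curve `u·diag((t+2)^w)·g·det_m` the degree-`k` annihilators Kuratowski-converge to the
`uᵀ`-preimage of `in_w^{low}(Ann_k(g·det_m))` (the span of lowest-`w`-weight parts), which turns (β)
into the crux's literal conclusion.  `line_reduction` composes (the five stub statements as explicit
hypotheses ⟹ the crux unfolded; sorry-free) and `ToricFixedPoints_of : ToricFixedPoints` plugs the five
`stub_*` in and transports along `crux_iff` (concludes the crux BY NAME; type-checks that the registered
signatures are literally the composition's hypotheses).

Disproof / Negative lemmas honoured.  `Negative/WithoutOrbitFalse.lean`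
(`toricFixedPoints_false_without_orbit`, imported below): the orbit clause W1 is consumed by
`stub_limitStructure` (dimension `C(m²+k-1,k) - C(m,k)²` of `Ann_k(P_t)`, false for `P_t = 0`) and
kept as a hypothesis of stubs 3–4; the Negative witness (`J_k` = all forms) violates `IsLimitSubspace`
in degree `0`, so no stub is an instance it refutes (`example` at the end of §0).  Disproof §0
ConstantCase (`u = 1, w = 0` for interior points) is the `A₀ = g·x|_{Y'}`, no-tail instance of stubs
3–4 at `m = n`; §3 `degree_zero_part` agrees with `skelModel`/`toricModel` in degree `0` (both `{0}`).
The standing Disproof.lean text (run/gate/evidence/…) was not mounted on this seat; its evidence notes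
(cycle-1 final) were used.

Conventions (all J-side = operator side, as the crux): `linSubst A : X_i ↦ Σ_j A j i • X_j`;
`D ⌟ (A·f) = A·((Aᵀ·D) ⌟ f)` (`apolarAction_linSubst`), so `Ann(A·f) = (linSubst Aᵀ)⁻¹' Ann(f)`;
`Ann_k(F(c·x)) = {E(c⁻¹·∂) : E ∈ Ann_k F}`, `c = (t+2)^w`, whose limit for `t → ∞` keeps the LOWEST
`w`-weight parts: `J`-side initial forms are `inBot w`, `V`-side ones the highest-weight parts.
`ZLight` (every monomial of degree `≤ m` containing an unused variable weighs less than every z-free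
monomial of the same degree) makes `V` avoid the unused variables and `J` prefer `∂_z` — the direction
of `U_P`-stability.

Sorries (planner's skeleton): exactly the five `stub_*`.

RESHAPE 1 (lead prover-line-stmt-ValiantsHypothesis-5779-b-0, second line lead, 2026-08-16): `stub_limitStructure`
and `stub_toricKLimit` are CLOSED from landed theorems (sibling crux FixedWitnessObstructionQP: `stub_annSubmodule`
p?, `stub_kuratowskiSubmodule`, `stub_limitIdeal`; first lead's S1 `stub_toricLimitIsInitial` p76357) — for this the
`J`-side initial forms are now written as `lowestForms w S` (lowest `weightedHomogeneousComponent`, the landed format)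
instead of the planner's `inBot` (same span: the two sets differ only by `0`), in both `toricModel` and `skelModel`;
`stub_h0Families` is stated def-free (W4 verbatim ⇒ three families with `IsOwn`/`rk` unfolded).  Open sorries: 3
(`stub_h0Families` [M, delegated], `stub_skeletonEndToric` [XL, lead], `stub_tailDistraction` [L/XL, delegated]).

RESHAPE 2 (lead b-0, after wave 1): `stub_h0Families` LANDED (p80706) and is closed here; `stub_skeletonEndToric` is
split into `stub_skeletonUnpadded` (m = n: the crux core) and `stub_skeletonPadded` (n < m: in doubt after worker B's
(3,5)/(2,4) findings, see its docstring), glued sorry-free.  Open sorries: 3 (`stub_skeletonUnpadded` [lead + worker C: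
(3,3) re-validation], `stub_skeletonPadded` [worker D: (3,5) exact decision], `stub_tailDistraction` [conjecture; open,
untestable until the padded skeleton stub is settled]).

LINE DEAD (lead b-0, 2026-08-16T17:30Z): `stub_skeletonPadded` is FALSE with exact witnesses — (3,4): the drefuter's TORIC H₀(3,4)-fixed point in
chamber C_big (A = ℓI₄ + N(Y,z) full; skeleton dims (10,30,10,1), impossible for one matrix by Theorem J: h(4)=1 ∧ h(3)=10 ⇒ Jordan ⇒ h(2) ≤ 20;
DREFUTE-SkeletonEndToric.md), and (3,5): worker D's theorem (no one-matrix skeleton for the seed-0 two-step point in any ℓ-dominant chamber,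
VERDICT35.md).  Lemma L (ZLight-toric(u=1) ⇔ End skeleton) shows no reshape keeps the composition.  See Lines/colon-tower-distraction-dead.md.
`stub_skeletonUnpadded` (= crux core) resists at (3,3): 2313/2332 two-step points toric, exact certificates (VERDICT33.md).  This file stays as the
record of the line; its closed parts (`stub_limitStructure`, `stub_toricKLimit`, `stub_h0Families` p80706, the glue) are reusable.
-/

namespace Summit.ValiantsHypothesis.ValiantsHypothesis.Cruxes.ToricFixedPoints.ColonTowerDistraction

open Literature.Computability.AlgebraicComplexity
open Summit.ValiantsHypothesis.ValiantsHypothesis.Theses.BorderApolarity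
open Filter
open scoped Matrix BigOperators

set_option linter.dupNamespace false

noncomputable section

/-! ## §0 Vocabulary — the crux's inline data, definitionally (`crux_iff` is `Iff.rfl`) -/

/-- The `rk` weight ordering the variables (`ℓ = (0,0)` and the `Y`-block first, the unused
variables last, row-major inside each group) — verbatim the crux's `let rk`. -/
def rk (n m : ℕ) [NeZero m] (p : Fin m × Fin m) : ℕ :=
  (if (m - n ≤ (p.1 : ℕ) ∧ m - n ≤ (p.2 : ℕ)) ∨ p = (0, 0) then 0 else m * m) + ((p.1 : ℕ) * m + (p.2 : ℕ))

/-- W4 of the crux, verbatim: stability of `J` under `D ↦ linSubst Mᵀ D` for every `M ∈ H₀(n,m)`. -/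
def IsH0Stable (n m : ℕ) [NeZero m] (J : ℕ → Set (MvPolynomial (Fin m × Fin m) ℂ)) : Prop :=
  ∀ A : Matrix.GeneralLinearGroup (Fin m × Fin m) ℂ,
    let M : Matrix (Fin m × Fin m) (Fin m × Fin m) ℂ := A
    (∀ i j : Fin m × Fin m, M j i ≠ 0 → rk n m j ≤ rk n m i) →
    (∀ i j : Fin m × Fin m, ((m - n ≤ (i.1 : ℕ) ∧ m - n ≤ (i.2 : ℕ)) ∨ i = (0, 0)) → j ≠ i → M j i = 0) →
    (∀ i k j l : Fin m, m - n ≤ (i : ℕ) → m - n ≤ (k : ℕ) → m - n ≤ (j : ℕ) → m - n ≤ (l : ℕ) →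
      M (i, j) (i, j) * M (k, l) (k, l) = M (i, l) (i, l) * M (k, j) (k, j)) →
    M (0, 0) (0, 0) ^ (m - n) * ∏ i ∈ Finset.univ.filter (fun i : Fin m => m - n ≤ (i : ℕ)), M (i, i) (i, i) = 1 →
    ∀ k ≤ m, ∀ D ∈ J k, linSubst (Fin m × Fin m) ℂ Mᵀ D ∈ J k

/-- The toric curve of the crux's conclusion, `Q_t = u · diag((t+2)^w) · g · det_m`. -/
def toricFamily (m : ℕ) (u g : Matrix.GeneralLinearGroup (Fin m × Fin m) ℂ) (w : Fin m × Fin m → ℤ) :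
    ℕ → MvPolynomial (Fin m × Fin m) ℂ := fun t =>
  linSubst (Fin m × Fin m) ℂ (u : Matrix (Fin m × Fin m) (Fin m × Fin m) ℂ)
    (linSubst (Fin m × Fin m) ℂ (Matrix.diagonal fun i : Fin m × Fin m => ((t : ℂ) + 2) ^ (w i))
      (linSubst (Fin m × Fin m) ℂ (g : Matrix (Fin m × Fin m) (Fin m × Fin m) ℂ) (detPoly (Fin m) ℂ)))

/-- The crux's conclusion: `J` is the degree-wise Kuratowski limit of `Ann(Q_t)` along some toric curve
(`IsBorderApolarLimit` is verbatim the pair of limit clauses). -/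
def ToricConclusion (m : ℕ) (J : ℕ → Set (MvPolynomial (Fin m × Fin m) ℂ)) : Prop :=
  ∃ (u g : Matrix.GeneralLinearGroup (Fin m × Fin m) ℂ) (w : Fin m × Fin m → ℤ),
    IsBorderApolarLimit m (toricFamily m u g w) J

/-- **The crux unfolded** (`Iff.rfl`: the inline `act` is `apolarAction`, the two limit clauses are
`IsBorderApolarLimit m P J`, W4 is `IsH0Stable`, the conclusion is `ToricConclusion`). [folklore] -/
theorem crux_iff :
    ToricFixedPoints ↔
      ∀ (n m : ℕ) [NeZero m], 3 ≤ n → n ≤ m →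
        ∀ (P : ℕ → MvPolynomial (Fin m × Fin m) ℂ) (J : ℕ → Set (MvPolynomial (Fin m × Fin m) ℂ)),
          (∀ t : ℕ, P t ∈ glOrbit (Fin m × Fin m) ℂ (detPoly (Fin m) ℂ)) →
          IsBorderApolarLimit m P J → IsH0Stable n m J → ToricConclusion m J :=
  Iff.rfl

/-- The **lowest-`w`-weight initial forms** of a set `S` of operators (`J`-side initial forms, in
the crux's `(t+2)^w` convention the limit keeps the LOWEST weights): all `weightedHomogeneousComponent w ν E`
with `E ∈ S` and every component of weight `< ν` vanishing (so `0` and the genuine lowest parts; the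
span is the initial subspace `in_w(span S)` when `S` is a subspace).  This is verbatim the set whose span
the landed `stub_toricLimitIsInitial` (Theorems/BorderApolarityToricFixedPointsToricLimitIsInitial) names. -/
def lowestForms {σ : Type*} (w : σ → ℤ) (S : Set (MvPolynomial σ ℂ)) : Set (MvPolynomial σ ℂ) :=
  {D' | ∃ E ∈ S, ∃ ν : ℤ, D' = MvPolynomial.weightedHomogeneousComponent w ν E ∧
    ∀ ν' : ℤ, ν' < ν → MvPolynomial.weightedHomogeneousComponent w ν' E = 0}

/-- **The toric model** `in_w^{low}(Ann_k(g · det_m))`: the span of the lowest-weight parts of the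
degree-`k` annihilators of the translate `g · det_m` — the degree-`k` piece of the Gröbner-type
degeneration of `(g·det_m)^⊥` that the crux's conclusion names (with `u = 1`); literally the set of the
landed `stub_toricLimitIsInitial` at `f = g · det_m`. -/
def toricModel (m k : ℕ) (g : Matrix.GeneralLinearGroup (Fin m × Fin m) ℂ) (w : Fin m × Fin m → ℤ) :
    Set (MvPolynomial (Fin m × Fin m) ℂ) :=
  ↑(Submodule.span ℂ (lowestForms w
      (annihilatorOfDegree
        (linSubst (Fin m × Fin m) ℂ (g : Matrix (Fin m × Fin m) (Fin m × Fin m) ℂ) (detPoly (Fin m) ℂ)) k)))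

/-- Own variable (`ℓ = X₀₀` or an entry of the `per`-block `Y`), verbatim the crux's test; the other
`m² - n² - 1` variables are the unused ("padding", `z`) ones. -/
def IsOwn (n m : ℕ) [NeZero m] (p : Fin m × Fin m) : Prop :=
  (m - n ≤ (p.1 : ℕ) ∧ m - n ≤ (p.2 : ℕ)) ∨ p = (0, 0)

instance (n m : ℕ) [NeZero m] : DecidablePred (IsOwn n m) := fun p => by
  unfold IsOwn; infer_instance

/-- `D` is z-FREE: no unused variable occurs in it (`D ∈ ℂ[∂_{Y'}]`, resp. `f ∈ ℂ[Y']`). -/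
def IsZFree (n m : ℕ) [NeZero m] (D : MvPolynomial (Fin m × Fin m) ℂ) : Prop :=
  ∀ s ∈ D.support, ∀ v : Fin m × Fin m, ¬ IsOwn n m v → s v = 0

/-- **The End-toric skeleton model** in degree `k`: the `w'`-initial system (lowest-weight parts,
spanned) of the z-free degree-`k` operators annihilating every `k × k` minor of the matrix `A₀` (an
`m × m` matrix of linear forms in the own variables; repeated/permuted index maps `r, c` only add `0`
and `±` copies, so `span` = span of the genuine minors).  Dually: `Ann` inside `ℂ[∂_{Y'}]_k` of
`in^{w'}_{high}(span M_k(A₀))`. -/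
def skelModel (n m k : ℕ) [NeZero m] (A₀ : Matrix (Fin m) (Fin m) (MvPolynomial (Fin m × Fin m) ℂ))
    (w' : Fin m × Fin m → ℤ) : Set (MvPolynomial (Fin m × Fin m) ℂ) :=
  ↑(Submodule.span ℂ (lowestForms w'
      {D | D.IsHomogeneous k ∧ IsZFree n m D ∧
        ∀ r c : Fin k → Fin m, apolarAction D (A₀.submatrix r c).det = 0}))

/-- **z-light weights** (the product / z-lexicographic cocharacter of the distraction, in the crux's
`(t+2)^w` convention): for every unused `z` and own `y, y'`, `w z + (m-1)·w y' < m·w y`.  Equivalently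
every monomial of degree `≤ m` containing an unused variable has smaller `w`-weight than every z-free
monomial of the same degree, so `V = J^⊥` (highest weights) avoids the unused variables and `J`
(lowest weights) prefers `∂_z` — the direction of `U_P`-stability.  Vacuous when `m = n`. -/
def ZLight (n m : ℕ) [NeZero m] (w : Fin m × Fin m → ℤ) : Prop :=
  ∀ z y y' : Fin m × Fin m, ¬ IsOwn n m z → IsOwn n m y → IsOwn n m y' →
    w z + ((m : ℤ) - 1) * w y' < (m : ℤ) * w y

/-- Normal form N1: each `J k` (`k ≤ m`) is a linear subspace of degree-`k` forms with the Hilbert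
function of `det_m^⊥`, `dim = C(m²+k-1,k) - C(m,k)²`. -/
def IsLimitSubspace (m : ℕ) (J : ℕ → Set (MvPolynomial (Fin m × Fin m) ℂ)) : Prop :=
  ∀ k ≤ m, ∃ Jk : Submodule ℂ (MvPolynomial (Fin m × Fin m) ℂ),
    (Jk : Set (MvPolynomial (Fin m × Fin m) ℂ)) = J k ∧
    Jk ≤ MvPolynomial.homogeneousSubmodule (Fin m × Fin m) ℂ k ∧
    Module.finrank ℂ Jk = Nat.choose (m * m + k - 1) k - (Nat.choose m k) ^ 2

/-- Normal form N2: `J` is an ideal truncation in degrees `≤ m` (`J_k · ∂_i ⊆ J_{k+1}`). -/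
def IsTruncatedIdeal (m : ℕ) (J : ℕ → Set (MvPolynomial (Fin m × Fin m) ℂ)) : Prop :=
  ∀ k : ℕ, k + 1 ≤ m → ∀ D ∈ J k, ∀ i : Fin m × Fin m, D * MvPolynomial.X i ∈ J (k + 1)

/-- Normal form N3 — the three one-parameter families of `H₀(n,m)` (as substitutions `linSubst Mᵀ`):
(U) `∂_y ↦ ∂_y + c·∂_z` for `y` own, `z` unused (the unipotent radical `U_P = Hom(Z, Y')`; its
derivative at `c = 0` is the card's C1 `X_z * pderiv y D ∈ J k`);
(B) `∂_z ↦ ∂_z + c·∂_{z'}` for unused `z ≠ z'` with `rk z ≤ rk z'` (Borel moves in the z-index, C2);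
(T) the diagonal torus `diag d`, rank-one pattern on the `Y`-block and character
`d₀₀^{m-n} Π_i d_{(i,i)} = 1` (B2: `ℓ`-degree, row/column-content and z-multidegree gradings). -/
def H0Families (n m : ℕ) [NeZero m] (J : ℕ → Set (MvPolynomial (Fin m × Fin m) ℂ)) : Prop :=
  (∀ y z : Fin m × Fin m, IsOwn n m y → ¬ IsOwn n m z → ∀ c : ℂ, ∀ k ≤ m, ∀ D ∈ J k,
      linSubst (Fin m × Fin m) ℂ (1 + c • Matrix.single z y (1 : ℂ)) D ∈ J k) ∧
  (∀ z z' : Fin m × Fin m, ¬ IsOwn n m z → ¬ IsOwn n m z' → z ≠ z' → rk n m z ≤ rk n m z' →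
      ∀ c : ℂ, ∀ k ≤ m, ∀ D ∈ J k,
        linSubst (Fin m × Fin m) ℂ (1 + c • Matrix.single z' z (1 : ℂ)) D ∈ J k) ∧
  (∀ d : Fin m × Fin m → ℂ, (∀ v, d v ≠ 0) →
      (∀ i k j l : Fin m, m - n ≤ (i : ℕ) → m - n ≤ (k : ℕ) → m - n ≤ (j : ℕ) → m - n ≤ (l : ℕ) →
        d (i, j) * d (k, l) = d (i, l) * d (k, j)) →
      d (0, 0) ^ (m - n) * ∏ i ∈ Finset.univ.filter (fun i : Fin m => m - n ≤ (i : ℕ)), d (i, i) = 1 →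
      ∀ k ≤ m, ∀ D ∈ J k, linSubst (Fin m × Fin m) ℂ (Matrix.diagonal d) D ∈ J k)

/-- **End-toric skeleton**: for ONE matrix `A₀` of z-free linear forms and ONE own-weight `w'`, the
z-free part of `J k` equals `skelModel n m k A₀ w'` in every degree `k ≤ m` (dually: the card's
skeleton `F_k(0) = V_k ∩ S_k(Y')` is `in^{w'}_{high}` of the span of the `k × k` minors of `A₀`).
Injectivity of `(ℓ,Y) ↦ A₀` is not postulated: it follows in degree `1` (`J 1 = 0`). -/
def HasEndToricSkeleton (n m : ℕ) [NeZero m] (J : ℕ → Set (MvPolynomial (Fin m × Fin m) ℂ)) : Prop :=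
  ∃ (A₀ : Matrix (Fin m) (Fin m) (MvPolynomial (Fin m × Fin m) ℂ)) (w' : Fin m × Fin m → ℤ),
    (∀ i j, (A₀ i j).IsHomogeneous 1 ∧ IsZFree n m (A₀ i j)) ∧
    ∀ k ≤ m, {D | D ∈ J k ∧ IsZFree n m D} = skelModel n m k A₀ w'

/-- Consistency with the landed Negative lemma (orbit clause load-bearing): its witness `P_t = 0`,
`J_k = {all degree-k forms}` is excluded by W1, which stubs 1, 3, 4 keep; in degree `0` it has
`dim J 0 = 1 ≠ 0 = C(m²-1,0) - C(m,0)²`, violating `IsLimitSubspace`. -/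
example : ¬ Summit.ValiantsHypothesis.Cruxes.ToricFixedPoints.Negative.ToricFixedPointsWithoutOrbit :=
  Summit.ValiantsHypothesis.Cruxes.ToricFixedPoints.Negative.toricFixedPoints_false_without_orbit

/-! ## §1 The registered stubs -/

/-- **stub_limitStructure** — CLOSED in this skeleton (reshaped by the lead, seat b-0: glued from the landed
`stub_annSubmodule` + `stub_kuratowskiSubmodule` + `stub_limitIdeal` of the sibling crux, exactly the sibling line's
`exists_limitSubmodule`; stated def-free).  Original description (size L; provable now; shared verbatim-in-content with the sibling line
`Cruxes/FixedWitnessObstructionQP/Lines/cone-purity-squeeze.lean` stubs 3+4+5, whose glue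
`exists_limitSubmodule` already assembles N1).  For `P_t ∈ GL·det_m` and `J` the degree-wise
Kuratowski limit of `Ann(P_t)` in degrees `≤ m`:
N1 — each `J k` is a subspace of degree-`k` forms of dimension `C(m²+k-1,k) - C(m,k)²`
(`Ann_k(g·det) = (gᵀ)⁻¹·Ann_k(det)`, `apolarAction_linSubst_eq_zero_iff`; `Ann_k(det_m)^⊥` = span of
the `k × k` minors, `Literature.Barriers.ValiantsHypothesis.flatteningRank_detPoly`; Kuratowski limits
of `d`-planes are `d`-planes: compactness of the unit sphere for `≥`, openness of independence for `≤`,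
this is where both limit clauses are used);
N2 — `D ∈ J k`, `k+1 ≤ m` ⇒ `D·∂_i ∈ J (k+1)` (`apolarAction_mul`/`apolarAction_X_mul`,
`tendsto_coeffVec_X_mul`, clause (Ls) with `φ = id`).
W1 is load-bearing (Negative/WithoutOrbitFalse: with `P_t = 0` N1 fails in degree 0).
Leans on: `IsBorderApolarLimit.exists_tendsto/mem_of_tendsto/isHomogeneous_of_mem`, `ApolarityAction`
API, Mathlib `IsCompact.tendsto_subseq`, `Module.finrank`, `MvPolynomial.homogeneousSubmodule`. -/
theorem stub_limitStructure (m : ℕ) (P : ℕ → MvPolynomial (Fin m × Fin m) ℂ)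
    (J : ℕ → Set (MvPolynomial (Fin m × Fin m) ℂ))
    (hW1 : ∀ t : ℕ, P t ∈ glOrbit (Fin m × Fin m) ℂ (detPoly (Fin m) ℂ))
    (hBL : IsBorderApolarLimit m P J) :
    (∀ k ≤ m, ∃ Jk : Submodule ℂ (MvPolynomial (Fin m × Fin m) ℂ),
      (Jk : Set (MvPolynomial (Fin m × Fin m) ℂ)) = J k ∧
      Jk ≤ MvPolynomial.homogeneousSubmodule (Fin m × Fin m) ℂ k ∧
      Module.finrank ℂ Jk = Nat.choose (m * m + k - 1) k - (Nat.choose m k) ^ 2) ∧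
    (∀ k : ℕ, k + 1 ≤ m → ∀ D ∈ J k, ∀ i : Fin m × Fin m, D * MvPolynomial.X i ∈ J (k + 1)) := by
  classical
  refine ⟨fun k hk => ?_, Summit.ValiantsHypothesis.ValiantsHypothesis.Theorems.BorderApolarityFixedWitnessObstructionQP.stub_limitIdeal m P J hBL⟩
  choose A hAcar hAle hAdim using fun t =>
    Summit.ValiantsHypothesis.ValiantsHypothesis.Theorems.BorderApolarityFixedWitnessObstructionQP.stub_annSubmodule m k (P t) (hW1 t)
  have hmemA : ∀ {t : ℕ} {E : MvPolynomial (Fin m × Fin m) ℂ},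
      E ∈ A t ↔ E ∈ annihilatorOfDegree (P t) k := fun {t E} => by
    rw [← SetLike.mem_coe, hAcar]
  refine Summit.ValiantsHypothesis.ValiantsHypothesis.Theorems.BorderApolarityFixedWitnessObstructionQP.stub_kuratowskiSubmodule k _ A (J k) hAle hAdim ?_ ?_
  · intro D hD
    obtain ⟨Ds, hDs, hlim⟩ := hBL.exists_tendsto hk hD
    exact ⟨Ds, fun t => hmemA.2 (hDs t), hlim⟩
  · intro D φ Ds hφ hDs hlim
    exact hBL.mem_of_tendsto hk hφ (fun t => hmemA.1 (hDs t)) hlim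

/-- **stub_h0Families** — CLOSED: LANDED p80706 (Theorems/BorderApolarityToricFixedPointsH0Families.lean, worker A of
wave 1).  (stated DEF-FREE by the lead, seat b-0: hypothesis = W4 verbatim as in the landed
`stub_h0Elementary`, conclusion = the three families of `H0Families` with `IsOwn`/`rk` unfolded; `IsH0Stable n m J →
H0Families n m J` is this by `Iff.rfl`).  (size M; "bookkeeping with teeth", checked by hand by all three triagers as
C1/C2/B2; the (U)+(T_Z) part is the sibling line's `stub_h0Elementary`).  From W4 derive the three
families of `H0Families`: take `M = 1 + c • single y z 1` (entry `(y,z)`: allowed since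
`rk y < m² ≤ rk z`; own columns stay diagonal; diagonal entries `1`, character `1`; `Mᵀ = 1 + c •
single z y 1`), `M = 1 + c • single z z' 1` for unused `z ≠ z'`, `rk z ≤ rk z'` (entry `(z,z')`,
column `z'` unused), and `M = diagonal d` (symmetric; clauses (iii),(iv) are the hypotheses on `d`);
invertibility via unipotence / `d v ≠ 0` (`Matrix.GeneralLinearGroup.mkOfDetNeZero`).
The four clauses must be checked against the `if`-defined `rk`. -/
theorem stub_h0Families (n m : ℕ) [NeZero m] (J : ℕ → Set (MvPolynomial (Fin m × Fin m) ℂ))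
    (hW4 : ∀ A : Matrix.GeneralLinearGroup (Fin m × Fin m) ℂ,
      let M : Matrix (Fin m × Fin m) (Fin m × Fin m) ℂ := A
      let rk := fun (p : Fin m × Fin m) =>
        (if (m - n ≤ (p.1 : ℕ) ∧ m - n ≤ (p.2 : ℕ)) ∨ p = (0, 0) then 0 else m * m) + ((p.1 : ℕ) * m + (p.2 : ℕ))
      (∀ i j : Fin m × Fin m, M j i ≠ 0 → rk j ≤ rk i) →
      (∀ i j : Fin m × Fin m, ((m - n ≤ (i.1 : ℕ) ∧ m - n ≤ (i.2 : ℕ)) ∨ i = (0, 0)) → j ≠ i → M j i = 0) →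
      (∀ i k j l : Fin m, m - n ≤ (i : ℕ) → m - n ≤ (k : ℕ) → m - n ≤ (j : ℕ) → m - n ≤ (l : ℕ) →
        M (i, j) (i, j) * M (k, l) (k, l) = M (i, l) (i, l) * M (k, j) (k, j)) →
      M (0, 0) (0, 0) ^ (m - n) * ∏ i ∈ Finset.univ.filter (fun i : Fin m => m - n ≤ (i : ℕ)), M (i, i) (i, i) = 1 →
      ∀ k ≤ m, ∀ D ∈ J k, linSubst (Fin m × Fin m) ℂ Mᵀ D ∈ J k) :
    (∀ y z : Fin m × Fin m,
        ((m - n ≤ (y.1 : ℕ) ∧ m - n ≤ (y.2 : ℕ)) ∨ y = (0, 0)) →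
        ¬ ((m - n ≤ (z.1 : ℕ) ∧ m - n ≤ (z.2 : ℕ)) ∨ z = (0, 0)) →
        ∀ c : ℂ, ∀ k ≤ m, ∀ D ∈ J k,
          linSubst (Fin m × Fin m) ℂ (1 + c • Matrix.single z y (1 : ℂ)) D ∈ J k) ∧
    (∀ z z' : Fin m × Fin m,
        ¬ ((m - n ≤ (z.1 : ℕ) ∧ m - n ≤ (z.2 : ℕ)) ∨ z = (0, 0)) →
        ¬ ((m - n ≤ (z'.1 : ℕ) ∧ m - n ≤ (z'.2 : ℕ)) ∨ z' = (0, 0)) → z ≠ z' →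
        (if (m - n ≤ (z.1 : ℕ) ∧ m - n ≤ (z.2 : ℕ)) ∨ z = (0, 0) then 0 else m * m) + ((z.1 : ℕ) * m + (z.2 : ℕ)) ≤
          (if (m - n ≤ (z'.1 : ℕ) ∧ m - n ≤ (z'.2 : ℕ)) ∨ z' = (0, 0) then 0 else m * m) +
            ((z'.1 : ℕ) * m + (z'.2 : ℕ)) →
        ∀ c : ℂ, ∀ k ≤ m, ∀ D ∈ J k,
          linSubst (Fin m × Fin m) ℂ (1 + c • Matrix.single z' z (1 : ℂ)) D ∈ J k) ∧
    (∀ d : Fin m × Fin m → ℂ, (∀ v, d v ≠ 0) →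
        (∀ i k j l : Fin m, m - n ≤ (i : ℕ) → m - n ≤ (k : ℕ) → m - n ≤ (j : ℕ) → m - n ≤ (l : ℕ) →
          d (i, j) * d (k, l) = d (i, l) * d (k, j)) →
        d (0, 0) ^ (m - n) * ∏ i ∈ Finset.univ.filter (fun i : Fin m => m - n ≤ (i : ℕ)), d (i, i) = 1 →
        ∀ k ≤ m, ∀ D ∈ J k, linSubst (Fin m × Fin m) ℂ (Matrix.diagonal d) D ∈ J k) :=
  Summit.ValiantsHypothesis.ValiantsHypothesis.Theorems.BorderApolarityToricFixedPoints.stub_h0Families n m J hW4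

/-- **stub_skeletonUnpadded** — THE CRUX CORE (split off by the lead, seat b-0, reshape 2): the unpadded case
`m = n` of the planner's `stub_skeletonEndToric`.  With no unused variables (`IsOwn n n = ⊤`, `IsZFree` trivial) it
says: every `T_det`-stable point `J` of `Z_det_n` (T_det = {diag(a_i b_j) : Π a_i b_i = 1} = H₀(n,n)) in normal form is the
`w'`-initial system (lowest parts) of the annihilator of the minors of ONE `n × n` matrix `A₀` of linear forms — by
`J 1 = 0` the entries of `A₀` are independent, `A₀ = g·x`, and this is the crux at `m = n` with `u = 1` (T'-absorption,
Disproof §4(a)).  Status: OPEN = the crux's core; evidence: cdisprove (3,3) census (9 488 T-fixed points, no certified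
non-toric one; but see worker B's warning in `work/stubs/tail/VERDICT.md` §0: the LM residual floor 1e-17/1e-18 read as
"numerically toric" is the signature of DEGENERATE pseudo-solutions — the 57 two-step-only points need re-validation).
Structural reduction (lead, NOTES §Math): a two-step point `in_λ(g₂ · in_ν(x₁))` is toric whenever `g₂ ∈ P_λ · N(T) · Z(ν)`;
the residual class is `l ẇ · in_{λ'}(u · in_ν(x'))` with `u ∈ U_ν^+ \ P_{λ'}` (simplest: `u = u_α(c)`, `⟨ν,α⟩ > 0 > ⟨λ',α⟩`). -/
theorem stub_skeletonUnpadded (n : ℕ) [NeZero n] (hn : 3 ≤ n)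
    (P : ℕ → MvPolynomial (Fin n × Fin n) ℂ) (J : ℕ → Set (MvPolynomial (Fin n × Fin n) ℂ))
    (hW1 : ∀ t : ℕ, P t ∈ glOrbit (Fin n × Fin n) ℂ (detPoly (Fin n) ℂ))
    (hBL : IsBorderApolarLimit n P J)
    (hN1 : IsLimitSubspace n J) (hN2 : IsTruncatedIdeal n J) (hN3 : H0Families n n J) :
    HasEndToricSkeleton n n J := by
  sorry

/-- **stub_skeletonPadded** — the padded case `n < m` of the planner's `stub_skeletonEndToric` (split off by the
lead, seat b-0, reshape 2): the z-FREE part of an `H₀(n,m)`-fixed point of `Z_det_m` in normal form is End-toric — ONE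
`m × m` matrix `A₀` of linear forms in the `n²+1` own variables and own-weights `w'` with `{D ∈ J k | D z-free} =
in^{w'}_{low}{D ∈ ℂ[∂_{Y'}]_k | D ⌟ μ = 0 for every k × k minor μ of A₀}` for all `k ≤ m`.
Status: IN DOUBT (worker B, wave 1, `work/stubs/tail/VERDICT.md`): at (3,4) the two-step H₀-fixed points are z-free and
their skeleton IS End-toric (40-digit Newton certificate, `points/check_34_0.log`); at (3,5) [in range] and (2,4)
[mechanism level] every tailed two-step point has a skeleton that is exactly `in_{λ'}` of an ARC LIMIT
`lim_s M(A(0) + sB^φ)` of End-systems over `Y'`, and every numerical fit by a SINGLE matrix `A₀` is degenerate (cubic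
minors of `A₀` become dependent along Newton continuation; residual floor 1e-17 vs 1e-27 for genuine solutions) —
no exact obstruction yet ((2,4) reduced to a finite case analysis, VERDICT §4).  If it dies, the honest replacement is
"skeleton = own-cocharacter initial space of an arc limit of End-systems", and `stub_tailDistraction` must be re-posed. -/
theorem stub_skeletonPadded (n m : ℕ) [NeZero m] (hn : 3 ≤ n) (hnm : n < m)
    (P : ℕ → MvPolynomial (Fin m × Fin m) ℂ) (J : ℕ → Set (MvPolynomial (Fin m × Fin m) ℂ))
    (hW1 : ∀ t : ℕ, P t ∈ glOrbit (Fin m × Fin m) ℂ (detPoly (Fin m) ℂ))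
    (hBL : IsBorderApolarLimit m P J)
    (hN1 : IsLimitSubspace m J) (hN2 : IsTruncatedIdeal m J) (hN3 : H0Families n m J) :
    HasEndToricSkeleton n m J := by
  sorry

/-- **stub_skeletonEndToric** (the planner's hardest stub) — now the COMPOSITION of `stub_skeletonUnpadded` (`m = n`)
and `stub_skeletonPadded` (`n < m`); sorry-free glue. [folklore] -/
theorem stub_skeletonEndToric (n m : ℕ) [NeZero m] (hn : 3 ≤ n) (hnm : n ≤ m)
    (P : ℕ → MvPolynomial (Fin m × Fin m) ℂ) (J : ℕ → Set (MvPolynomial (Fin m × Fin m) ℂ))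
    (hW1 : ∀ t : ℕ, P t ∈ glOrbit (Fin m × Fin m) ℂ (detPoly (Fin m) ℂ))
    (hBL : IsBorderApolarLimit m P J)
    (hN1 : IsLimitSubspace m J) (hN2 : IsTruncatedIdeal m J) (hN3 : H0Families n m J) :
    HasEndToricSkeleton n m J := by
  rcases Nat.lt_or_ge n m with hlt | hge
  · exact stub_skeletonPadded n m hn hlt P J hW1 hBL hN1 hN2 hN3
  · obtain rfl : n = m := le_antisymm hnm hge
    exact stub_skeletonUnpadded n hn P J hW1 hBL hN1 hN2 hN3

/-- **stub_tailDistraction** — THE CARD'S LEVER (b), load-bearing for this line (size L/XL).  An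
`H₀(n,m)`-fixed point of `Z_det_m` in normal form whose z-free skeleton is End-toric is a toric limit
with z-LIGHT weights: `J k = in_w^{low}(Ann_k(g·det_m))` for all `k ≤ m`, some `g ∈ GL_{m²}` and `w`
with `ZLight n m w` (and `u = 1`).  Intended proof = the colon tower read constructively, top degree
down: (1) tower normal form from N1–N3 (infinitesimal (U): `Y'·F_d(γ) ⊆ F_{d+1}(γ - e_j)`, (B): strong
stability in the z-index, (T): gradings, N2: closure under `∂`; budget `Σ dim F = C(m,k)²`, e.g. in
degree `m-1`: `dim V_{m-1} = m² = (n²+1) + N` over `[ℓ^{m-n}per_n]` with `(∂P : Y') = 0`, one tail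
dimension per unused variable); (2) ansatz `g·x = A₀' + Σ_z z·B_z` for a representation `(A₀', w')` of
the skeleton, `w = (w'; z-weights decreasing along rk, spaced geometrically, all far below w')`, so
that `in_w` of a combination of minors is computed by the SAME recursion as the tower (z-free part if
non-zero, else the part linear in the rk-last unused variable present, …); (3) matching `V_k` degree by
degree is a block-triangular linear system for the constant matrices `B_z`, solvable because each tail
space sits in the iterated colon it must come from — membership `J ∈ Z_det` (W1–W3, KEPT as
hypotheses: the abstract tower conditions alone admit non-realisable staircases) is what guarantees a
solution; (4) equality from the dimension count N1 (`dim in_w = dim`).  NOT claimed (refuted at (2,4),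
TRIAGE r1-2 A1): uniqueness of the tower over a skeleton — different fixed points over one skeleton get
different `B_z`.
WHY IT MIGHT FAIL: an `H₀`-fixed two-step point `in_λ(u·lim_s A(s))` (TRIAGE r1-2 A2 generator) that is
toric only with some unused variable heavier than an own one, or not toric at all while its skeleton is
End-toric; cheapest test: the 17 `H₀(3,5)`-fixed points of `dump35_all.jsonl` (skeleton `ℓ²det₃(Y)`-type,
45 tails in `V_2`): solve (3) for `B_z ∈ ℂ^{5×5}`, 15 unused variables, exact linear algebra. -/
theorem stub_tailDistraction (n m : ℕ) [NeZero m] (hn : 3 ≤ n) (hnm : n ≤ m)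
    (P : ℕ → MvPolynomial (Fin m × Fin m) ℂ) (J : ℕ → Set (MvPolynomial (Fin m × Fin m) ℂ))
    (hW1 : ∀ t : ℕ, P t ∈ glOrbit (Fin m × Fin m) ℂ (detPoly (Fin m) ℂ))
    (hBL : IsBorderApolarLimit m P J)
    (hN1 : IsLimitSubspace m J) (hN2 : IsTruncatedIdeal m J) (hN3 : H0Families n m J)
    (hSk : HasEndToricSkeleton n m J) :
    ∃ (g : Matrix.GeneralLinearGroup (Fin m × Fin m) ℂ) (w : Fin m × Fin m → ℤ),
      ZLight n m w ∧ ∀ k ≤ m, J k = toricModel m k g w := by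
  sorry

/-- **stub_toricKLimit** — CLOSED in this skeleton (reshaped by the lead, seat b-0: `toricModel` is now literally the
lowest-weight span of the landed `stub_toricLimitIsInitial` (first lead's S1, p76357) at `f = g·det_m`, `d := m`).
Original description (size M/L; provable now; the A1 lemma `ToricLimitIsInitial` all three cards
share, in the crux's exact format).  Along the toric curve `Q_t = u·diag((t+2)^w)·g·det_m` the
degree-`k` annihilators converge in the Kuratowski sense (both clauses of `IsBorderApolarLimit`, every
`k ≤ d`, any `d`) to `{D | uᵀ·D ∈ in_w^{low}(Ann_k(g·det_m))}`:
`Ann(u·G) = (linSubst uᵀ)⁻¹' Ann(G)` (`apolarAction_linSubst_eq_zero_iff`), `Ann_k(F(c·x)) =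
{E(c⁻¹∂) : E ∈ Ann_k F}` with `c = (t+2)^w`, and `E(c⁻¹∂) = Σ_e (t+2)^{-⟨w,e⟩} E_e ∂^e` spans, in the
limit `t → ∞`, the line of its lowest-`w`-weight part; for the subspace use a basis adapted to the
weight filtration (`dim in_w A = dim A`: tree `GradedLimit.finrank_grSub` / `WtInit.finrank_stage_eq`,
`GradedInitialSubspace.lean`), (Li) by explicit approximants `c_t⁻¹·E`, (Ls) by `dim`-many independent
limits + closedness.  No genericity of `w` needed; `(t+2) ≥ 2` avoids `0^w`. -/
theorem stub_toricKLimit (m : ℕ) (u g : Matrix.GeneralLinearGroup (Fin m × Fin m) ℂ)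
    (w : Fin m × Fin m → ℤ) :
    IsBorderApolarLimit m (toricFamily m u g w)
      (fun k => {D | linSubst (Fin m × Fin m) ℂ (u : Matrix (Fin m × Fin m) (Fin m × Fin m) ℂ)ᵀ D ∈
        toricModel m k g w}) :=
  Summit.ValiantsHypothesis.ValiantsHypothesis.Theorems.BorderApolarityToricFixedPoints.stub_toricLimitIsInitial m u w
    (linSubst (Fin m × Fin m) ℂ (g : Matrix (Fin m × Fin m) (Fin m × Fin m) ℂ) (detPoly (Fin m) ℂ))

/-! ## §2 The composition: stubs ⟹ the crux, by name (sorry-free) -/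

/-- **`line_reduction`** — the five stub STATEMENTS, as explicit hypotheses, imply the crux UNFOLDED
(the right-hand side of `crux_iff`; sorry-free and independent of the stubs' proofs):
normal form (h₁, h₂) ⟶ End-toric skeleton (h₃) ⟶ z-light toric realisation `J k = toricModel` (h₄) ⟶
the literal Kuratowski conclusion with `u = 1` (h₅ at `u = 1`, where the `uᵀ`-preimage is the identity:
`Units.val_one`, `Matrix.transpose_one`, `linSubst_one`). [folklore] -/
theorem line_reduction
    (h₁ : ∀ (m : ℕ) (P : ℕ → MvPolynomial (Fin m × Fin m) ℂ) (J : ℕ → Set (MvPolynomial (Fin m × Fin m) ℂ)),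
      (∀ t : ℕ, P t ∈ glOrbit (Fin m × Fin m) ℂ (detPoly (Fin m) ℂ)) →
      IsBorderApolarLimit m P J → IsLimitSubspace m J ∧ IsTruncatedIdeal m J)
    (h₂ : ∀ (n m : ℕ) [NeZero m] (J : ℕ → Set (MvPolynomial (Fin m × Fin m) ℂ)),
      IsH0Stable n m J → H0Families n m J)
    (h₃ : ∀ (n m : ℕ) [NeZero m], 3 ≤ n → n ≤ m →
      ∀ (P : ℕ → MvPolynomial (Fin m × Fin m) ℂ) (J : ℕ → Set (MvPolynomial (Fin m × Fin m) ℂ)),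
      (∀ t : ℕ, P t ∈ glOrbit (Fin m × Fin m) ℂ (detPoly (Fin m) ℂ)) →
      IsBorderApolarLimit m P J → IsLimitSubspace m J → IsTruncatedIdeal m J → H0Families n m J →
      HasEndToricSkeleton n m J)
    (h₄ : ∀ (n m : ℕ) [NeZero m], 3 ≤ n → n ≤ m →
      ∀ (P : ℕ → MvPolynomial (Fin m × Fin m) ℂ) (J : ℕ → Set (MvPolynomial (Fin m × Fin m) ℂ)),
      (∀ t : ℕ, P t ∈ glOrbit (Fin m × Fin m) ℂ (detPoly (Fin m) ℂ)) →
      IsBorderApolarLimit m P J → IsLimitSubspace m J → IsTruncatedIdeal m J → H0Families n m J →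
      HasEndToricSkeleton n m J →
      ∃ (g : Matrix.GeneralLinearGroup (Fin m × Fin m) ℂ) (w : Fin m × Fin m → ℤ),
        ZLight n m w ∧ ∀ k ≤ m, J k = toricModel m k g w)
    (h₅ : ∀ (m : ℕ) (u g : Matrix.GeneralLinearGroup (Fin m × Fin m) ℂ) (w : Fin m × Fin m → ℤ),
      IsBorderApolarLimit m (toricFamily m u g w)
        (fun k => {D | linSubst (Fin m × Fin m) ℂ (u : Matrix (Fin m × Fin m) (Fin m × Fin m) ℂ)ᵀ D ∈
          toricModel m k g w})) :
    ∀ (n m : ℕ) [NeZero m], 3 ≤ n → n ≤ m →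
      ∀ (P : ℕ → MvPolynomial (Fin m × Fin m) ℂ) (J : ℕ → Set (MvPolynomial (Fin m × Fin m) ℂ)),
        (∀ t : ℕ, P t ∈ glOrbit (Fin m × Fin m) ℂ (detPoly (Fin m) ℂ)) →
        IsBorderApolarLimit m P J → IsH0Stable n m J → ToricConclusion m J := by
  intro n m _ hn hnm P J hW1 hBL hW4
  obtain ⟨hN1, hN2⟩ := h₁ m P J hW1 hBL
  have hN3 := h₂ n m J hW4
  have hSk := h₃ n m hn hnm P J hW1 hBL hN1 hN2 hN3
  obtain ⟨g, w, -, hJ⟩ := h₄ n m hn hnm P J hW1 hBL hN1 hN2 hN3 hSk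
  refine ⟨1, g, w, ?_⟩
  have hlim := h₅ m 1 g w
  have hL : (fun k => {D | linSubst (Fin m × Fin m) ℂ
      ((1 : Matrix.GeneralLinearGroup (Fin m × Fin m) ℂ) : Matrix (Fin m × Fin m) (Fin m × Fin m) ℂ)ᵀ D ∈
        toricModel m k g w}) = fun k => toricModel m k g w := by
    funext k
    ext D
    simp [linSubst_one]
  rw [hL] at hlim
  show IsBorderApolarLimit m (toricFamily m 1 g w) J
  constructor
  · intro k hk D hD
    rw [hJ k hk] at hD
    exact hlim.1 k hk D hD
  · intro k hk D φ Ds hφ hDs hl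
    rw [hJ k hk]
    exact hlim.2 k hk D φ Ds hφ hDs hl

/-- **The line closes the crux, by name.**  The registered stubs plugged into `line_reduction` (their
signatures are literally its hypotheses) and transported along `crux_iff`; the only `sorry`s in the cone
of this theorem are the five `stub_*`. [folklore] -/
theorem ToricFixedPoints_of : ToricFixedPoints :=
  crux_iff.2 (line_reduction (fun m P J hW1 hBL => stub_limitStructure m P J hW1 hBL)
    (fun n m _ J hW4 => stub_h0Families n m J hW4) stub_skeletonEndToric stub_tailDistraction
    stub_toricKLimit)

end

end Summit.ValiantsHypothesis.ValiantsHypothesis.Cruxes.ToricFixedPoints.ColonTowerDistraction
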